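import Summits.BirchSwinnertonDyer.BirchSwinnertonDyer.Theorems.AlignedTransportAtTwoMainConjectureOfRankZeroBSDAtTwoTwinValueParity
import Mathlib.NumberTheory.Padics.Hensel
import Mathlib.RingTheory.PowerSeries.WeierstrassPreparation
import HarnessLib

/-!
# Route `AlignedTransportAtTwo`, crux C2 `MainConjectureOfRankZeroBSDAtTwo` (stmt-BirchSwinnertonDyer-22298):
# A NEWTON SEGMENT OF LENGTH ONE in `Λ = ℤ₂⟦T⟧` — Weierstrass preparation + Hensel's lemma: a `2`-free series with `λ ≥ 3`,
# `4 ∣ π₀` and `2 ∥ π₁` has a `ℤ₂`-rational zero in `2ℤ₂`, hence is NOT irreducible (tool for the twin-value door's `λ = 2`)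

HONEST FRAMING (cell `bsd-f1-sign2`, WIDTH-5 attached prover seat `bsd-line-att-p5` gen 49 on line `birth` of the lead
`bsd-line-att-p2`; `--supports` stmt-BirchSwinnertonDyer-22298, closes nothing; BSD is NOT proved by any of this; the crux
C2, its verdict «blocked-on `Rank1Residual.GreenbergMuConjectureIrreducible`» and every registered stub are untouched).
THEOREMS ONLY — no `def`, no instance, no named fact, no `sorry`. Pure commutative algebra of `ℤ₂⟦T⟧` (Mathlib's
`PowerSeries.exists_isWeierstrassFactorization` and `hensels_lemma`); consumed by `…TwinValueLambda` (`λ = 2` in the door).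

* `exists_eq_two_mul_unit`, `norm_two`, `valuation_eq_zero_of_isUnit`, `norm_le_half_of_two_dvd` — `2`-adic bookkeeping;
* ★★ `not_irreducible_of_hensel` — `π ≠ 0`, `μ(π) = 0`, `3 ≤ λ(π)`, `4 ∣ π₀`, `4 ∤ π₁` ⟹ `π` is NOT irreducible: prepare `π = f·h` (`f` distinguished,
  `deg f = λ(π)`), `f₀ = 4w`, `f₁ = 2v` (`v` a unit), `a = −f₀/f₁ ∈ 2ℤ₂`, `f(a) = a²q(a) ∈ 8ℤ₂`, `f′(a) ∈ 2ℤ₂ˣ`, Hensel ⟹ a root `z ∈ 2ℤ₂`,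
  `(T − z) ∣ π` with `λ(T − z) = 1 < λ(π)`.

References: L. Washington, GTM 83, Thm. 7.3 (Weierstrass preparation), §7.1 [Washington1997]; Hensel's lemma over `ℤ_p` (Mathlib
`hensels_lemma`) [folklore]; R. Greenberg, LNM 1716 (1999) §5 (Newton polygons of characteristic series) [GreenbergLNM1716].
-/

set_option linter.dupNamespace false
set_option autoImplicit false

noncomputable section

open scoped Classical

namespace Summit.BirchSwinnertonDyer.BirchSwinnertonDyer.Theorems.AlignedTransportAtTwoTwinValueLambda

open PowerSeries Literature.NumberTheory.EllipticCurves Literature.NumberTheory.EllipticCurves.IwasawaAlgebra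
  Summit.BirchSwinnertonDyer.Rank1Residual.X1.MuLambda Summit.BirchSwinnertonDyer.Rank1Residual.X1.ParitySqueeze
  Summit.BirchSwinnertonDyer.Rank1Residual.Supersingular Summit.BirchSwinnertonDyer.Rank1Residual.Supersingular.BlindLever
  Summit.BirchSwinnertonDyer.BirchSwinnertonDyer.Theorems
  Summit.BirchSwinnertonDyer.BirchSwinnertonDyer.Theorems.AlignedTransportAtTwoTwinValueAlgebra

/-! ## §1 A length-one Newton segment: Weierstrass preparation + Hensel ⟹ a linear factor -/

section Hensel

/-- `2 ∣ x`, `4 ∤ x` in `ℤ₂` means `x = 2v` with `v` a unit. [folklore] -/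
theorem exists_eq_two_mul_unit {x : ℤ_[2]} (h2 : (2 : ℤ_[2]) ∣ x) (h4 : ¬ (4 : ℤ_[2]) ∣ x) :
    ∃ v : ℤ_[2], IsUnit v ∧ x = 2 * v := by
  obtain ⟨v, rfl⟩ := h2
  refine ⟨v, ?_, rfl⟩
  by_contra hv
  apply h4
  have hlt : ‖v‖ < 1 := lt_of_le_of_ne (PadicInt.norm_le_one v) (fun h ↦ hv (PadicInt.isUnit_iff.mpr h))
  obtain ⟨w, hw⟩ := (PadicInt.norm_lt_one_iff_dvd v).mp hlt
  refine ⟨w, ?_⟩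
  rw [hw, Nat.cast_ofNat]
  ring

/-- `‖2‖₂ = ½` in `ℤ₂`. [folklore] -/
theorem norm_two : ‖(2 : ℤ_[2])‖ = (2 : ℝ)⁻¹ := by
  have h := PadicInt.norm_p (p := 2)
  rw [Nat.cast_ofNat] at h
  rw [h]; norm_num

/-- A unit of `ℤ₂` has `2`-adic order `0`. [folklore] -/
theorem valuation_eq_zero_of_isUnit {x : ℤ_[2]} (hx : IsUnit x) : x.valuation = 0 := by
  have hn : ‖x‖ = 1 := PadicInt.isUnit_iff.mp hx
  have h' := PadicInt.norm_eq_zpow_neg_valuation hx.ne_zero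
  rw [hn] at h'
  have h3 : (2 : ℝ) ^ (-(x.valuation : ℤ)) = (2 : ℝ) ^ (0 : ℤ) := by
    rw [zpow_zero]; exact_mod_cast h'.symm
  have := zpow_right_injective₀ (by norm_num) (by norm_num) h3
  omega

/-- An element of `ℤ₂` divisible by `2` has norm `≤ ½ < 1`. [folklore] -/
theorem norm_le_half_of_two_dvd {x : ℤ_[2]} (h : (2 : ℤ_[2]) ∣ x) : ‖x‖ ≤ (2 : ℝ)⁻¹ := by
  obtain ⟨y, rfl⟩ := h
  rw [norm_mul, norm_two]
  exact mul_le_of_le_one_right (by norm_num) (PadicInt.norm_le_one y)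

/-- **Newton segment of length one.** Let `π ∈ Λ = ℤ₂⟦T⟧` be non-zero with `μ(π) = 0`, `λ(π) ≥ 3`, `4 ∣ π₀` and `2 ∥ π₁`. Then `π` is
NOT irreducible: Weierstrass-prepare `π = f·h` (`f` distinguished of degree `λ(π)`); with `f₀ = 4w·unit`, `f₁ = 2v` (`v` a unit) and
`a := −f₀/f₁ ∈ 2ℤ₂` one has `f(a) = a²·q(a) ∈ 8ℤ₂` and `f′(a) = f₁ + 4(…) ∈ 2ℤ₂ˣ`, so Hensel's lemma gives a root `z ∈ 2ℤ₂` of `f`, and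
`(T − z) ∣ π` with `λ(T − z) = 1`. [cite: Washington1997, Thm. 7.3 and §7.1] -/
theorem not_irreducible_of_hensel {π : IwasawaAlgebra 2} (hπ0 : π ≠ 0) (hμ : mu π = 0) (hd : 3 ≤ lam π)
    (h0 : (4 : ℤ_[2]) ∣ constantCoeff π) (h1' : ¬ (4 : ℤ_[2]) ∣ coeff 1 π) : ¬ Irreducible π := by
  intro hirr
  -- Weierstrass preparation `π = f * h`
  have hpf : pfree π = π := by
    have h := eq_C_pow_mu_mul_pfree π
    rw [hμ, pow_zero, map_one, one_mul] at h
    exact h.symm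
  have hred : PowerSeries.map (IsLocalRing.residue ℤ_[2]) π ≠ 0 := by
    have h := red_pfree_ne_zero hπ0
    rwa [hpf] at h
  obtain ⟨f, h, H⟩ := PowerSeries.exists_isWeierstrassFactorization hred
  have hfd : f.IsDistinguishedAt (IsLocalRing.maximalIdeal ℤ_[2]) := H.isDistinguishedAt
  have hhu : IsUnit h := H.isUnit
  have heq : π = (f : PowerSeries ℤ_[2]) * h := H.eq_mul
  have hdeg : f.natDegree = lam π := by
    rw [H.natDegree_eq_toNat_order_map, lam, hpf]
  have hd3 : 3 ≤ f.natDegree := by rw [hdeg]; exact hd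
  -- low coefficients of `f` lie in `𝔪 = (2)`
  have hmem : ∀ k, k < f.natDegree → (2 : ℤ_[2]) ∣ f.coeff k := by
    intro k hk
    have hk' := hfd.toIsWeaklyEisensteinAt.mem hk
    rw [PadicInt.maximalIdeal_eq_span_p, Ideal.mem_span_singleton, Nat.cast_ofNat] at hk'
    exact hk'
  -- constant terms: `π₀ = f₀ h₀`, `π₁ = f₀ h₁ + f₁ h₀`, `h₀` a unit
  have hh0 : IsUnit (constantCoeff h) := isUnit_iff_constantCoeff.mp hhu
  have e0 : constantCoeff π = f.coeff 0 * constantCoeff h := by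
    rw [heq, map_mul, ← coeff_zero_eq_constantCoeff_apply (f : PowerSeries ℤ_[2]), Polynomial.coeff_coe]
  have e1 : coeff 1 π = f.coeff 0 * coeff 1 h + f.coeff 1 * constantCoeff h := by
    rw [heq, coeff_mul, Finset.Nat.antidiagonal_succ, Finset.sum_cons, Finset.Nat.antidiagonal_zero]
    simp [Polynomial.coeff_coe, coeff_zero_eq_constantCoeff_apply]
  -- `4 ∣ f₀` and `2 ∥ f₁`
  obtain ⟨u0, hu0⟩ := hh0
  have hf0 : (4 : ℤ_[2]) ∣ f.coeff 0 := by
    have : f.coeff 0 = constantCoeff π * ↑u0⁻¹ := by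
      rw [e0, ← hu0, mul_assoc, Units.mul_inv, mul_one]
    rw [this]; exact dvd_mul_of_dvd_left h0 _
  have hf1 : (2 : ℤ_[2]) ∣ f.coeff 1 := hmem 1 (by omega)
  have hf1' : ¬ (4 : ℤ_[2]) ∣ f.coeff 1 := by
    intro h4
    apply h1'
    rw [e1]
    exact dvd_add (dvd_mul_of_dvd_left hf0 _) (dvd_mul_of_dvd_left h4 _)
  obtain ⟨v, hv, hf1v⟩ := exists_eq_two_mul_unit hf1 hf1'
  obtain ⟨w, hw⟩ := hf0
  obtain ⟨vu, rfl⟩ := hv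
  -- the approximate root `a = −f₀/f₁ = −2 w / v`
  set a : ℤ_[2] := -(2 * w * ↑vu⁻¹) with ha
  have hlin : f.coeff 0 + f.coeff 1 * a = 0 := by
    rw [hw, hf1v, ha]
    have : (vu : ℤ_[2]) * ↑vu⁻¹ = 1 := Units.mul_inv vu
    linear_combination (-(4 : ℤ_[2]) * w) * this
  have ha2 : (2 : ℤ_[2]) ∣ a := ⟨-(w * ↑vu⁻¹), by rw [ha]; ring⟩
  -- `f = f₀ + f₁ X + X² q`
  set q : Polynomial ℤ_[2] := f.divX.divX with hq
  have hfq : f = Polynomial.C (f.coeff 0) + Polynomial.X * Polynomial.C (f.coeff 1) + Polynomial.X ^ 2 * q := by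
    have h1 := Polynomial.X_mul_divX_add f
    have h2 := Polynomial.X_mul_divX_add f.divX
    rw [Polynomial.coeff_divX, zero_add] at h2
    rw [hq]
    linear_combination -h1 - Polynomial.X * h2
  -- `2 ∣ q(a)` (as `q(a) ≡ q(0) = f₂ (mod a)` and `2 ∣ f₂`, `2 ∣ a`)
  have hq0 : q.coeff 0 = f.coeff 2 := by rw [hq, Polynomial.coeff_divX, Polynomial.coeff_divX]
  have hqa : (2 : ℤ_[2]) ∣ q.eval a := by
    have hsub : a - 0 ∣ q.eval a - q.eval 0 := Polynomial.sub_dvd_eval_sub a 0 q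
    rw [sub_zero, ← Polynomial.coeff_zero_eq_eval_zero, hq0] at hsub
    have h2' : (2 : ℤ_[2]) ∣ q.eval a - f.coeff 2 := dvd_trans ha2 hsub
    have hf2 : (2 : ℤ_[2]) ∣ f.coeff 2 := hmem 2 (by omega)
    have := dvd_add h2' hf2
    rwa [sub_add_cancel] at this
  -- `f(a) = a² q(a) ∈ 8ℤ₂`
  have heval : f.eval a = a ^ 2 * q.eval a := by
    conv_lhs => rw [hfq]
    simp only [Polynomial.eval_add, Polynomial.eval_mul, Polynomial.eval_C, Polynomial.eval_X, Polynomial.eval_pow]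
    linear_combination hlin
  have h8 : (8 : ℤ_[2]) ∣ f.eval a := by
    rw [heval]
    obtain ⟨a', ha'⟩ := ha2
    obtain ⟨c, hc⟩ := hqa
    exact ⟨a' ^ 2 * c, by rw [hc, ha']; ring⟩
  -- `f'(a) = f₁ + 4(…)`, a unit times `2`
  have hder_eval : ∃ c : ℤ_[2], (Polynomial.derivative f).eval a = f.coeff 1 + 4 * c := by
    obtain ⟨a', ha'⟩ := ha2
    refine ⟨a' * q.eval a + a' ^ 2 * (Polynomial.derivative q).eval a, ?_⟩
    have hd' : (Polynomial.derivative f).eval a = f.coeff 1 + (2 * a * q.eval a + a ^ 2 * (Polynomial.derivative q).eval a) := by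
      conv_lhs => rw [hfq]
      simp only [Polynomial.derivative_add, Polynomial.derivative_mul, Polynomial.derivative_C, Polynomial.derivative_X,
        Polynomial.derivative_X_pow, Polynomial.eval_add, Polynomial.eval_mul, Polynomial.eval_C, Polynomial.eval_X,
        Polynomial.eval_pow, zero_add, one_mul, add_zero, mul_zero, Nat.cast_ofNat]
      ring
    rw [hd', ha']
    ring
  have hnorm_der : ‖(Polynomial.derivative f).eval a‖ = (2 : ℝ)⁻¹ := by
    obtain ⟨c, hc⟩ := hder_eval
    have hunit : IsUnit ((vu : ℤ_[2]) + 2 * c) := by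
      -- `vu + 2c` differs from the unit `vu` by a non-unit
      have hlt : ‖((vu : ℤ_[2]) + 2 * c) - vu‖ < 1 := by
        rw [add_sub_cancel_left]
        exact lt_of_le_of_lt (norm_le_half_of_two_dvd ⟨c, rfl⟩) (by norm_num)
      exact PadicInt.isUnit_iff.mpr ((norm_eq_one_iff_of_norm_sub_lt_one hlt).mpr (PadicInt.isUnit_iff.mp vu.isUnit))
    have : (Polynomial.derivative f).eval a = 2 * ((vu : ℤ_[2]) + 2 * c) := by rw [hc, hf1v]; ring
    rw [this, norm_mul, norm_two, PadicInt.isUnit_iff.mp hunit, mul_one]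
  have hnorm_eval : ‖f.eval a‖ ≤ (2 : ℝ)⁻¹ ^ 3 := by
    obtain ⟨c, hc⟩ := h8
    rw [hc, norm_mul, show (8 : ℤ_[2]) = 2 ^ 3 by norm_num, norm_pow, norm_two]
    exact mul_le_of_le_one_right (by positivity) (PadicInt.norm_le_one c)
  -- Hensel
  have hhensel : ‖Polynomial.aeval a f‖ < ‖Polynomial.aeval a (Polynomial.derivative f)‖ ^ 2 := by
    rw [Polynomial.coe_aeval_eq_eval, hnorm_der]
    calc ‖f.eval a‖ ≤ (2 : ℝ)⁻¹ ^ 3 := hnorm_eval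
      _ < ((2 : ℝ)⁻¹) ^ 2 := by norm_num
  obtain ⟨z, hz, hza, -, -⟩ := hensels_lemma hhensel
  rw [Polynomial.coe_aeval_eq_eval] at hz hza
  rw [hnorm_der] at hza
  -- `z ∈ 2ℤ₂`
  have hz1 : ‖z‖ < 1 := by
    calc ‖z‖ = ‖(z - a) + a‖ := by rw [sub_add_cancel]
      _ ≤ max ‖z - a‖ ‖a‖ := PadicInt.nonarchimedean _ _
      _ < 1 := max_lt (lt_trans hza (by norm_num)) (lt_of_le_of_lt (norm_le_half_of_two_dvd ha2) (by norm_num))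
  have hzm : z ∈ IsLocalRing.maximalIdeal ℤ_[2] := by
    rw [PadicInt.maximalIdeal_eq_span_p, Ideal.mem_span_singleton]
    exact (PadicInt.norm_lt_one_iff_dvd z).mp hz1
  -- `(X − z) ∣ f ∣ π`
  have hdvd : (Polynomial.X - Polynomial.C z) ∣ f := Polynomial.dvd_iff_isRoot.mpr hz
  obtain ⟨r, hr⟩ := hdvd
  have hπfac : π = ((Polynomial.X - Polynomial.C z : Polynomial ℤ_[2]) : PowerSeries ℤ_[2]) * ((r : PowerSeries ℤ_[2]) * h) := by
    rw [heq, hr, Polynomial.coe_mul, mul_assoc]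
  -- the linear factor is distinguished, `λ = 1`, not a unit
  have hlin_dist : (Polynomial.X - Polynomial.C z).IsDistinguishedAt (IsLocalRing.maximalIdeal ℤ_[2]) := by
    refine ⟨⟨fun {n} hn ↦ ?_⟩, Polynomial.monic_X_sub_C z⟩
    rw [Polynomial.natDegree_X_sub_C] at hn
    have hn0 : n = 0 := by omega
    subst hn0
    rw [Polynomial.coeff_sub, Polynomial.coeff_X_zero, Polynomial.coeff_C_zero, zero_sub]
    exact neg_mem hzm
  have hlam1 : lam (((Polynomial.X - Polynomial.C z : Polynomial ℤ_[2]) : PowerSeries ℤ_[2]) : IwasawaAlgebra 2) = 1 := by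
    rw [lam_coe_eq_natDegree hlin_dist, Polynomial.natDegree_X_sub_C]
  have hlin_nu : ¬ IsUnit (((Polynomial.X - Polynomial.C z : Polynomial ℤ_[2]) : PowerSeries ℤ_[2]) : IwasawaAlgebra 2) := by
    intro hu
    have := ((isUnit_iff_mu_eq_zero_and_lam_eq_zero _).mp hu).2.2
    rw [hlam1] at this
    exact one_ne_zero this
  -- irreducibility forces the cofactor to be a unit, hence `λ(π) = 1`
  rcases hirr.isUnit_or_isUnit hπfac with hu | hu
  · exact hlin_nu hu
  · have hne1 : (((Polynomial.X - Polynomial.C z : Polynomial ℤ_[2]) : PowerSeries ℤ_[2]) : IwasawaAlgebra 2) ≠ 0 :=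
      coe_ne_zero_of_isDistinguishedAt hlin_dist
    have hne2 : ((r : PowerSeries ℤ_[2]) * h : IwasawaAlgebra 2) ≠ 0 := hu.ne_zero
    have hlamπ : lam π = 1 := by
      rw [hπfac, lam_mul hne1 hne2, hlam1, lam_eq_zero_of_isUnit hu]
    omega

end Hensel

end Summit.BirchSwinnertonDyer.BirchSwinnertonDyer.Theorems.AlignedTransportAtTwoTwinValueLambda

end
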